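import Summits.HodgeConjecture.HodgeConjecture.Theorems.MarkmanPartnerTransportPicardThreeK3SquaresOneCycleDegree
import Summits.HodgeConjecture.HodgeConjecture.Theorems.MarkmanPartnerTransportPicardThreeK3SquaresOneCycleCorrespondence

/-!
# Route MarkmanPartnerTransport · crux `PicardThreeK3Squares` (stmt-HodgeConjecture-19652) —
# ONE CYCLE SUFFICES, part 6: the Hodge conjecture for `S × S` from ONE cycle whose `(2,0)`-eigenvalue
# has large degree (`22 - ρ(S) ≠ k·j·m`), reaching `ρ(S) ∈ {2, 4, 6, 10}`

Conclusion of the degree form (part 5, `generatedBy_or_hasComplexMultiplication_of_eigenvalue_natDegree`):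
for a projective K3 surface `S` and ONE endomorphism `e` of `H²(S(ℂ); ℂ)` preserving rational classes
and Hodge types, induced by an algebraic class on `S × S`, acting on a non-zero `(2,0)`-class by a number
`ev` of degree `k = deg minpoly_ℚ(ev)` with `k · j · m + ρ(S) ≠ 22` for all `j ≥ 2`, `m ≥ 3`:

* `hodgeConjectureFor_square_of_oneCycle_natDegree` (not CM, markings only) /
  `hodgeConjectureFor_square_of_oneCycle_natDegree_of_buskin` (any `S`; CM branch by Buskin) —
  `HodgeConjectureFor 4 (S ⊗ S)`;
* `hodgeConjectureFor_square_of_oneCycle_of_six_mul_lt` — the same under the memorable sufficient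
  condition `22 - ρ(S) < 6k` (then `k·j·m ≥ 6k > 22 - ρ`);
* `hodgeConjectureFor_square_of_pushPull_natDegree` — the push–pull form `f₊ g^*` through any smooth
  projective surface (van Geemen–Schütt's mechanism) with an eigenvalue of degree `k`, `22 - ρ(S) < 6k`.

Reach (with part 3): crux #4's residue `ρ(S) ∈ {4, 6, 7, 8, 10, 12, 13, 14, 16}` is reduced to ONE cycle
at `ρ ∈ {7, 8, 12, 13, 14, 16}` unconditionally on the degree, at `ρ = 10` for eigenvalues of degree
`k ≥ 3` (e.g. the cubic `ℚ(ζ₉ + ζ₉⁻¹)` type of van Geemen–Schütt Thm. 1.1 (9)), at `ρ = 6` for `k = 4`,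
at `ρ = 4` for `k ≥ 4` (`k = 6`); and outside the crux at `ρ = 2` for `k ≥ 4` (the quintic
`ℚ(ζ₁₁ + ζ₁₁⁻¹)` type of Thm. 1.1 (11), which feeds crux #5 through Hilbert squares). What is NOT reached
by one cycle: quadratic eigenvalues at `ρ ∈ {2, 4, 6, 10}` and cubic ones at `ρ = 4` (a larger totally
real field containing the eigenvalue field is arithmetically possible; the generation clause or a second
cycle is then needed).

No definition, no sorry; named facts (`Huybrechts_K3_marking_exists`, `Buskin2019_hodgeIsometry_algebraic`)
only as hypotheses. Prover seat hodge-nonav-19652-p1 (gen 8), `--supports stmt-HodgeConjecture-19652`.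
Nothing here proves the crux or the Hodge conjecture.

References: van Geemen–Schütt, Forum Math. Sigma 13 (2025) e2, Thm. 1.1 (9), (11), §2.1, §4.8, Rem. 4.9;
van Geemen, Michigan Math. J. 56 (2008), Lemma 3.2; Varesco, Math. Z. 305 (2023), §2 (p. 8); Buskin,
J. reine angew. Math. 755 (2019), Thm. 1.1; Fulton, *Intersection Theory*, §16.1 Prop. 16.1.1.
-/

set_option linter.dupNamespace false

noncomputable section

namespace Summit.HodgeConjecture.HodgeConjecture.Theorems.MarkmanPartnerTransport.OneCycle

open scoped Manifold TensorProduct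
open Module CategoryTheory MonoidalCategory CartesianMonoidalCategory Polynomial
open Literature.AlgebraicGeometry Literature.AlgebraicGeometry.Motives Literature.AlgebraicGeometry.HodgeTheory
open Literature.AlgebraicGeometry.Surfaces
open Literature.AlgebraicTopology.SingularHomology
open Summit.HodgeConjecture.HodgeConjecture.Theorems
open Summit.HodgeConjecture.HodgeConjecture.Theorems.NikulinTwinTransport

/-- `Corr[μ, hS ; γ, y] = pr₁_*(pr₂^* y ∪ γ)` on `H²(S(ℂ); ℂ)`. Local notation only. -/
local notation3 (prettyPrint := false) "Corr[" μ ", " hS " ; " γ ", " y "]" =>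
  complexGysin μ (IsSmoothProjective.tensor_holds hS hS) hS
    (SemiCartesianMonoidalCategory.fst _ _) (rfl : 2 * 1 + 2 * 2 + 2 * 2 = 2 * 1 + 2 * (2 + 2))
    (cupProduct (rfl : 2 * 1 + 2 * 2 = 2 * 1 + 2 * 2)
      (complexBetti.map (SemiCartesianMonoidalCategory.snd _ _) (2 * 1) y) γ)

variable {S Y : SchemeOver ℂ}

/-- **ONE CYCLE SUFFICES, degree form (non-CM surfaces; markings only).** Let `S` be a projective K3
surface, not of CM type, and `e` an endomorphism of `H²(S(ℂ); ℂ)` preserving rational classes and Hodge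
types, induced by an algebraic class on `S × S` (orientation family `μ`), acting on a non-zero
`(2,0)`-class by `ev` with `(minpoly ℚ ev).natDegree = k` and `k · j · m + ρ(S) ≠ 22` for all `j ≥ 2`,
`m ≥ 3`. Then `HodgeConjectureFor 4 (S ⊗ S)` (part 5 + `mapsTo_algebraicClasses_one` +
`hodgeConjectureFor_square_of_generatedBy_of_mapsTo`). [cite: Varesco2023, §2 (p. 8)]
[cite: GeemenSchutt2023, §4.8 and Rem. 4.9] [cite: Vangeemen2008, Lemma 3.2] -/
theorem hodgeConjectureFor_square_of_oneCycle_natDegree (hmark : Huybrechts_K3_marking_exists)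
    (hS : IsK3Surface S) {k : ℕ}
    (hk : ∀ j m : ℕ, 2 ≤ j → 3 ≤ m → k * j * m + Module.finrank ℂ ↥(algebraicClasses S 1) ≠ 22)
    (hCM : ¬ HasComplexMultiplication S) (μ : OrientationFamily)
    (e : complexBetti S (2 * 1) →ₗ[ℂ] complexBetti S (2 * 1))
    (he_rat : ∀ y, IsRationalClass y → IsRationalClass (e y))
    (he_typ : ∀ (i j : ℕ) y, IsOfHodgeType 2 S (2 * 1) i j y → IsOfHodgeType 2 S (2 * 1) i j (e y))
    (he_cyc : ∃ γ ∈ algebraicClasses (S ⊗ S) 2, ∀ y : complexBetti S (2 * 1),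
      e y = Corr[μ, hS.isSmoothProjective ; γ, y])
    (he_ev : ∃ (σ₀ : complexBetti S (2 * 1)) (ev : ℂ), IsOfHodgeType 2 S (2 * 1) 2 0 σ₀ ∧ σ₀ ≠ 0 ∧
      e σ₀ = ev • σ₀ ∧ (minpoly ℚ ev).natDegree = k) :
    HodgeConjectureFor 4 (S ⊗ S) := by
  rcases generatedBy_or_hasComplexMultiplication_of_eigenvalue_natDegree hmark hS hk e he_rat he_typ he_ev
    with hgen | hCM'
  · exact hodgeConjectureFor_square_of_generatedBy_of_mapsTo μ hS.isSmoothProjective e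
      (mapsTo_algebraicClasses_one hS.isSmoothProjective e he_rat he_typ) he_cyc hgen
  · exact absurd hCM' hCM

/-- **ONE CYCLE SUFFICES, degree form (every projective K3 surface; CM branch by Buskin's Thm. 1.1).**
[cite: Buskin2019, Thm. 1.1] [cite: Varesco2023, §2 (p. 8)] [cite: GeemenSchutt2023, §4.8 and Rem. 4.9] -/
theorem hodgeConjectureFor_square_of_oneCycle_natDegree_of_buskin (hB : Buskin2019_hodgeIsometry_algebraic)
    (hmark : Huybrechts_K3_marking_exists) (hS : IsK3Surface S) {k : ℕ}
    (hk : ∀ j m : ℕ, 2 ≤ j → 3 ≤ m → k * j * m + Module.finrank ℂ ↥(algebraicClasses S 1) ≠ 22)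
    (μ : OrientationFamily) (e : complexBetti S (2 * 1) →ₗ[ℂ] complexBetti S (2 * 1))
    (he_rat : ∀ y, IsRationalClass y → IsRationalClass (e y))
    (he_typ : ∀ (i j : ℕ) y, IsOfHodgeType 2 S (2 * 1) i j y → IsOfHodgeType 2 S (2 * 1) i j (e y))
    (he_cyc : ∃ γ ∈ algebraicClasses (S ⊗ S) 2, ∀ y : complexBetti S (2 * 1),
      e y = Corr[μ, hS.isSmoothProjective ; γ, y])
    (he_ev : ∃ (σ₀ : complexBetti S (2 * 1)) (ev : ℂ), IsOfHodgeType 2 S (2 * 1) 2 0 σ₀ ∧ σ₀ ≠ 0 ∧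
      e σ₀ = ev • σ₀ ∧ (minpoly ℚ ev).natDegree = k) :
    HodgeConjectureFor 4 (S ⊗ S) := by
  rcases generatedBy_or_hasComplexMultiplication_of_eigenvalue_natDegree hmark hS hk e he_rat he_typ he_ev
    with hgen | hCM
  · exact hodgeConjectureFor_square_of_generatedBy_of_mapsTo μ hS.isSmoothProjective e
      (mapsTo_algebraicClasses_one hS.isSmoothProjective e he_rat he_typ) he_cyc hgen
  · exact CMThird.hodgeConjectureFor_square_of_CM_of_buskin hB hmark S hS hCM

/-- `22 - ρ < 6k` rules out every factorisation `k · j · m + ρ = 22` with `j ≥ 2`, `m ≥ 3`. [folklore] -/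
theorem mul_mul_add_ne_of_lt_six_mul {ρ k j m : ℕ} (h : 22 < 6 * k + ρ) (hj : 2 ≤ j) (hm : 3 ≤ m) :
    k * j * m + ρ ≠ 22 := by
  have h6 : 6 * k ≤ k * j * m := by
    calc 6 * k = k * 2 * 3 := by ring
      _ ≤ k * j * m := Nat.mul_le_mul (Nat.mul_le_mul le_rfl hj) hm
  omega

/-- **ONE CYCLE SUFFICES whenever `22 - ρ(S) < 6 · deg(ev)`** (every projective K3 surface; CM branch by
Buskin): e.g. a cycle-induced endomorphism with a CUBIC eigenvalue at `ρ(S) = 10` (van Geemen–Schütt's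
`ℚ(ζ₉ + ζ₉⁻¹)` type, Thm. 1.1 (9): the generation clause of `IsCycleInducedRMK3` is redundant there), a
QUARTIC one at `ρ(S) ∈ {2, …, 6}`, a QUINTIC one at `ρ(S) = 2` (`ℚ(ζ₁₁ + ζ₁₁⁻¹)`, Thm. 1.1 (11)).
[cite: GeemenSchutt2023, Thm. 1.1 (9), (11), §4.8 and Rem. 4.9] [cite: Vangeemen2008, Lemma 3.2]
[cite: Buskin2019, Thm. 1.1] -/
theorem hodgeConjectureFor_square_of_oneCycle_of_six_mul_lt (hB : Buskin2019_hodgeIsometry_algebraic)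
    (hmark : Huybrechts_K3_marking_exists) (hS : IsK3Surface S) {k : ℕ}
    (hk : 22 < 6 * k + Module.finrank ℂ ↥(algebraicClasses S 1))
    (μ : OrientationFamily) (e : complexBetti S (2 * 1) →ₗ[ℂ] complexBetti S (2 * 1))
    (he_rat : ∀ y, IsRationalClass y → IsRationalClass (e y))
    (he_typ : ∀ (i j : ℕ) y, IsOfHodgeType 2 S (2 * 1) i j y → IsOfHodgeType 2 S (2 * 1) i j (e y))
    (he_cyc : ∃ γ ∈ algebraicClasses (S ⊗ S) 2, ∀ y : complexBetti S (2 * 1),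
      e y = Corr[μ, hS.isSmoothProjective ; γ, y])
    (he_ev : ∃ (σ₀ : complexBetti S (2 * 1)) (ev : ℂ), IsOfHodgeType 2 S (2 * 1) 2 0 σ₀ ∧ σ₀ ≠ 0 ∧
      e σ₀ = ev • σ₀ ∧ (minpoly ℚ ev).natDegree = k) :
    HodgeConjectureFor 4 (S ⊗ S) :=
  hodgeConjectureFor_square_of_oneCycle_natDegree_of_buskin hB hmark hS
    (fun _ _ hj hm ↦ mul_mul_add_ne_of_lt_six_mul hk hj hm) μ e he_rat he_typ he_cyc he_ev

/-- **The push–pull form with an eigenvalue of large degree**: for a projective K3 surface `S`, a smooth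
projective surface `Y` and `f g : Y ⟶ S`, if `f₊ g^*` (complex orientations) acts on a non-zero
`(2,0)`-class by `ev` with `22 - ρ(S) < 6 · deg minpoly_ℚ(ev)`, then `HodgeConjectureFor 4 (S ⊗ S)`
(mod Buskin for the CM branch, and markings) — van Geemen–Schütt's dihedral construction read
abstractly: a surface mapping to `S` twice whose push–pull multiplies `ω_S` by `2cos(2π/n)`, `n ∈ {9, 11}`.
[cite: GeemenSchutt2023, Prop. 4.6, §4.8, §5.6 and §5.8] [cite: Fulton1998, §16.1 Prop. 16.1.1]
[cite: Buskin2019, Thm. 1.1] -/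
theorem hodgeConjectureFor_square_of_pushPull_natDegree (hB : Buskin2019_hodgeIsometry_algebraic)
    (hmark : Huybrechts_K3_marking_exists) (hS : IsK3Surface S) {k : ℕ}
    (hk : 22 < 6 * k + Module.finrank ℂ ↥(algebraicClasses S 1))
    (hY : IsSmoothProjective 2 Y) (f g : Y ⟶ S)
    (hev : ∃ (σ₀ : complexBetti S (2 * 1)) (ev : ℂ), IsOfHodgeType 2 S (2 * 1) 2 0 σ₀ ∧ σ₀ ≠ 0 ∧
      complexGysin complexOrientationFamily hY hS.isSmoothProjective f (rfl : 2 * 1 + 2 * 2 = 2 * 1 + 2 * 2)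
        (complexBetti.map g (2 * 1) σ₀) = ev • σ₀ ∧ (minpoly ℚ ev).natDegree = k) :
    HodgeConjectureFor 4 (S ⊗ S) := by
  have hSsp := hS.isSmoothProjective
  set e : complexBetti S (2 * 1) →ₗ[ℂ] complexBetti S (2 * 1) :=
    complexGysin complexOrientationFamily hY hSsp f (rfl : 2 * 1 + 2 * 2 = 2 * 1 + 2 * 2) ∘ₗ
      (complexBetti.map g (2 * 1)).hom with he
  have he_app : ∀ y, e y = complexGysin complexOrientationFamily hY hSsp f
      (rfl : 2 * 1 + 2 * 2 = 2 * 1 + 2 * 2) (complexBetti.map g (2 * 1) y) := fun _ ↦ rfl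
  obtain ⟨γ, hγ, hγe⟩ := exists_algebraic_corrAction_eq_of_pushPull (μ := complexOrientationFamily)
    complexOrientationFamily.hasPoincareDuality hSsp (a := 2 * 1) (T := e)
    ⟨Y, hY, f, g, 1, by rw [one_smul]⟩
  have he_cyc : ∃ γ ∈ algebraicClasses (S ⊗ S) 2, ∀ y : complexBetti S (2 * 1),
      e y = Corr[complexOrientationFamily, hSsp ; γ, y] :=
    ⟨γ, hγ, fun y ↦ by rw [← hγe]; rfl⟩
  have he_rat : ∀ y, IsRationalClass y → IsRationalClass (e y) := fun y hy ↦ by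
    rw [he_app]
    exact isRationalClass_complexGysin_complexOrientationFamily hY hSsp f rfl
      (hy.map (AlgPoints.mapContinuous (L := ℂ) g))
  have he_typ : ∀ (i j : ℕ) y, IsOfHodgeType 2 S (2 * 1) i j y →
      IsOfHodgeType 2 S (2 * 1) i j (e y) := fun i j y hy ↦ by
    rw [he_app]
    exact isOfHodgeType_complexGysin_map complexOrientationFamily hSsp hY f g rfl rfl rfl hy
  obtain ⟨σ₀, ev, h20, hne, heq, hdeg⟩ := hev
  exact hodgeConjectureFor_square_of_oneCycle_of_six_mul_lt hB hmark hS hk complexOrientationFamily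
    e he_rat he_typ he_cyc ⟨σ₀, ev, h20, hne, by rw [he_app]; exact heq, hdeg⟩

end Summit.HodgeConjecture.HodgeConjecture.Theorems.MarkmanPartnerTransport.OneCycle

end
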